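import Mathlib
import Literature.NumberTheory.LFunctions.Zhang2022.Section17Eq172Head
import Literature.NumberTheory.LFunctions.Zhang2022.Section14Eq143Core
import Literature.NumberTheory.LFunctions.Zhang2022.Section17MeanSquareMajorant
import Literature.NumberTheory.LFunctions.Zhang2022.Section3Prop21
import HarnessLib

/-!
# Zhang (2022) §17 (17.2), second half: "extend the sum over `Ψ₁` to the sum over `Ψ` with an
# acceptable error" — `Σ_{ψ∈Ψ₂} |(1/2πi)∫_{𝔍(1)}𝔨₃(s,ψ)ω(s)ds| = o(𝔓)` by the (7.5)/(14.3) method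

Topic `Literature/NumberTheory/LFunctions/Zhang2022` (Landau–Siegel audit tree; verdict-neutral).
Y. Zhang, *Discrete mean estimates and the Landau–Siegel zero*, arXiv:2211.02515v1 (2022)
[Zhang2022LandauSiegel] — **an unrefereed manuscript under adjudication**; nothing here asserts or
denies its Theorems 1–2. DAG node `Z22:(17.2)` [Z22 p.95, tex L4711–L4716]: "… and then extend the
sum over `Ψ₁` to the sum over `Ψ` with an acceptable error". The manuscript gives no proof; the method
is the one it uses for the twins (7.3)→(7.5) (§7 p.35, tex L1893–L1905: "To handle the sum over `m < P²`
we move the path of integration to `𝔍(0)` … by Cauchy's inequality,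
`≤ (Σ_Ψ|Σ_m …|²)^{1/2}(Σ_Ψ|A|⁴)^{1/4}(Σ_{Ψ₂}1)^{1/4}` … This yields (7.5) by Proposition 2.1 and (2.9)")
and (14.3) (§14 p.76), kernel-checked for (14.3) in `Typed.Sec14.Eq143.core` (`Section14Eq143Core`),
whose exponent bookkeeping is reused here. PROVED (theorems only; no definitions, no named facts):

* `sum_sq_head_le` — Lemma 3.3 (ii) (`Skeleton.lemma33b_holds`) for the head
  `K_M(s,ψ) = Σ_{m≤M}ν*(m)ψ(m)m^{−s}` on `Re s = ½`: `Σ_Ψ|K_M|² ≤ C₃₃P²·K_ι²·majorantConst 64 16·(log M)^{64}`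
  (`|ν*| ≤ K_ιτ₈`, `Σ_{m≤M}τ₈²/m ≪ (log M)^{64}`) — the cut `M = D^{240}` keeps `log M = 240𝓛`
  (with `M = P²` the exponent `(2𝓛⁹)^{64}` would not be affordable);
* `sum_pow_four_F_le` — `Σ_Ψ|F(1−s,ψ̄)|⁴ ≤ C₃₃P²·majorantConst 16 8·(2𝓛⁹)^{16}` on `Re s = ½`
  (`F² = Σ_{k≤D⁸}(ν′⋆ν′)(k)ψ̄(k)k^{s−1}`, `|ν′⋆ν′| ≤ τ₄`, `Section7Eq75.sq_dirPoly_eq`);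
* `core172` — with Proposition 2.1 (`Skeleton.prop21_holds`): on `Re s = ½`,
  `Σ_{ψ∈Ψ₂}|K_M(s,ψ)||F(1−s,ψ̄)| ≤ K·𝔓·𝓛⁻⁵⁹` (`X⁴ ≤ U²V·#Ψ₂ ≤ c𝔓⁴𝓛^{2(64+77)+(144+77)−739}`);
* `sum_PsiTwo_norm_segInt_kfrak3_le` — **the extension error**: for every `ε > 0`, all large `D`,
  under (A), `Σ_{ψ∈Ψ₂}‖(1/2πi)∫_{𝔍(1)}𝔨₃(s,ψ)ω(s)ds‖ ≤ ε𝔓` (per character: tail of the `ν*`-series and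
  Cauchy move of the entire head integrand to `𝔍(0)`, `Section17Eq172Head`; then `∫_{𝔍(0)}|ω||ds| ≪ 1`,
  (7.4) = `Section7aStatements.eq74_holds`, and `core172` pointwise in `Im s`); and its weighted form
  `norm_sum_PsiTwo_weighted_le` with `|(p_ψt₀)^{β₃}| = 1`.

ZHANG-L discharge lane (WP16, seat zl-w16-p6), helper toward the leaf `Typed.Section17.Eq17_6Rel`;
together with `Eq172.eq17_2a_of_prop22i` (`Section17Eq172Shift`) it yields (17.2) (`Section17Eq172`).
WHAT THIS IS NOT: a claim about Theorems 1–2 of the source or about Landau–Siegel zeros.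

## References

* Y. Zhang, arXiv:2211.02515v1 (2022), §17 (17.2) p.95; §7 (7.3)–(7.5) pp.34–35; §14 (14.3) p.76;
  §2 (2.9), Prop. 2.1; §3 Lemma 3.3. [cite: Zhang2022LandauSiegel, §17 (17.2) p.95]
-/

noncomputable section

open Finset Complex Real MeasureTheory intervalIntegral ComplexConjugate
open Literature.NumberTheory.LFunctions.Zhang2022.Skeleton
open Literature.NumberTheory.LFunctions.Zhang2022.Typed.Section17
open Literature.NumberTheory.LFunctions.Zhang2022.MeanSquareMajorant
open Literature.NumberTheory.LFunctions.Zhang2022.Typed.Sec14.Eq143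
  (card_finsetOf pow_four_le bigP_sq_le floor_bigP_sq_facts)

namespace Literature.NumberTheory.LFunctions.Zhang2022.Eq172

/-- An eventual statement may assume `D ≥ D₁`. [cite: Zhang2022LandauSiegel, §2 p. 4] -/
private theorem forAllLarge_ge (D₁ : ℕ) : ForAllLarge fun D _ _ => D₁ ≤ D :=
  ForAllLarge.of_le D₁ fun _ _ _ hD _ _ => hD

/-! ## The second moment of the head `K_M` (Lemma 3.3 (ii) + `τ₈`-moment) -/

/-- **`Σ_{ψ∈Ψ}|Σ_{m≤M} ν*(m)ψ(m)m^{−s}|² ≤ C₃₃P²·K_ι²·majorantConst 64 16·(log M)^{64}`** on `Re s = ½`, for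
`2 ≤ M ≤ ⌊P²⌋` and `𝓛 ≥ 2`: Lemma 3.3 (ii) with the coefficients `ν*·[m ≤ M]`, `|ν*| ≤ K_ιτ₈`, and
`Σ_{m≤M}τ₈(m)²/m ≤ majorantConst 64 16·(log M)^{64}`. [cite: Zhang2022LandauSiegel, §7 (7.5) p.35; §3 Lemma 3.3] -/
theorem sum_sq_head_le (c' : ℝ) {D : ℕ} [Fintype (Chr D)] (χ : DirichletCharacter ℂ D)
    (hlog : 2 ≤ Real.log D) {C₃₃ : ℝ}
    (h33 : ∀ (s : ℂ) (c : ℕ → ℂ),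
      ∑ᶠ x : Chr D, ‖∑ n ∈ Icc 1 ⌊bigP D ^ 2⌋₊, c n * x.ψ (n : ZMod x.p) * (n : ℂ) ^ (-s)‖ ^ 2
        ≤ C₃₃ * bigP D ^ 2 * ∑ n ∈ Icc 1 ⌊bigP D ^ 2⌋₊, ‖c n‖ ^ 2 * (n : ℝ) ^ (-2 * s.re))
    {M : ℕ} (hM2 : 2 ≤ M) (hMP : M ≤ ⌊bigP D ^ 2⌋₊) {s : ℂ} (hs : s.re = 1 / 2) :
    ∑ x : Chr D, ‖∑ m ∈ Icc 1 M, nuStar c' χ m * psiFn x m * (m : ℂ) ^ (-s)‖ ^ 2 ≤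
      max C₃₃ 0 * bigP D ^ 2 * (((1 + ‖iota2‖) * (‖iota3‖ + ‖iota4‖)) ^ 2 *
        (majorantConst 64 16 * Real.log M ^ 64)) := by
  classical
  set X : ℕ := ⌊bigP D ^ 2⌋₊ with hXdef
  set K : ℝ := (1 + ‖iota2‖) * (‖iota3‖ + ‖iota4‖) with hK
  have hK0 : 0 ≤ K := Kiota_nonneg
  set c : ℕ → ℂ := fun n => if n ≤ M then nuStar c' χ n else 0 with hc
  -- the head is the `c`-polynomial of length `⌊P²⌋`
  have hsub : Icc 1 M ⊆ Icc 1 X := Icc_subset_Icc_right hMP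
  have hzero : ∀ n ∈ Icc 1 X, n ∉ Icc 1 M → c n = 0 := by
    intro n hn hnM
    have : ¬ n ≤ M := fun h => hnM (mem_Icc.mpr ⟨(mem_Icc.mp hn).1, h⟩)
    simp only [hc, this, if_false]
  have hpoly : ∀ x : Chr D, ∑ n ∈ Icc 1 X, c n * x.ψ (n : ZMod x.p) * (n : ℂ) ^ (-s) =
      ∑ m ∈ Icc 1 M, nuStar c' χ m * psiFn x m * (m : ℂ) ^ (-s) := by
    intro x
    have h1 : ∑ m ∈ Icc 1 M, nuStar c' χ m * psiFn x m * (m : ℂ) ^ (-s) =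
        ∑ m ∈ Icc 1 M, c m * x.ψ (m : ZMod x.p) * (m : ℂ) ^ (-s) :=
      sum_congr rfl fun n hn => by simp only [hc, (mem_Icc.mp hn).2, if_true, psiFn]
    rw [h1]
    exact (sum_subset hsub fun n hn hnM => by rw [hzero n hn hnM, zero_mul, zero_mul]).symm
  have key := h33 s c
  rw [finsum_eq_sum_of_fintype, hs] at key
  simp_rw [hpoly] at key
  -- the coefficient moment
  have hW : ∑ n ∈ Icc 1 X, ‖c n‖ ^ 2 * (n : ℝ) ^ (-2 * (1 / 2 : ℝ)) = ∑ n ∈ Icc 1 M, ‖c n‖ ^ 2 / n := by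
    have h1 : ∑ n ∈ Icc 1 M, ‖c n‖ ^ 2 / n = ∑ n ∈ Icc 1 M, ‖c n‖ ^ 2 * (n : ℝ) ^ (-2 * (1 / 2 : ℝ)) :=
      sum_congr rfl fun n _ => by
        rw [show -2 * (1 / 2 : ℝ) = -1 by norm_num, Real.rpow_neg_one, div_eq_mul_inv]
    rw [h1]
    exact (sum_subset hsub fun n hn hnM => by rw [hzero n hn hnM, norm_zero]; simp).symm
  rw [hW] at key
  have hcle : ∀ n, n ≠ 0 → ‖c n‖ ≤ K * tau 8 n := by
    intro n _
    simp only [hc]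
    split_ifs
    · exact norm_nuStar_le_tau c' χ hlog n
    · rw [norm_zero]; exact mul_nonneg hK0 (tau_nonneg _ _)
  have hmom := sum_norm_sq_div_le_of_le hcle M
  have hτ := sum_tau_sq_div_le 8 hM2
  norm_num at hτ
  have hMc := majorantConst_pos 64 16
  have hW1 : ∑ n ∈ Icc 1 M, ‖c n‖ ^ 2 / n ≤ K ^ 2 * (majorantConst 64 16 * Real.log M ^ 64) :=
    hmom.trans (mul_le_mul_of_nonneg_left hτ (sq_nonneg _))
  have hP : 0 ≤ bigP D ^ 2 := sq_nonneg _
  calc ∑ x : Chr D, ‖∑ m ∈ Icc 1 M, nuStar c' χ m * psiFn x m * (m : ℂ) ^ (-s)‖ ^ 2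
      ≤ C₃₃ * bigP D ^ 2 * ∑ n ∈ Icc 1 M, ‖c n‖ ^ 2 / n := key
    _ ≤ max C₃₃ 0 * bigP D ^ 2 * ∑ n ∈ Icc 1 M, ‖c n‖ ^ 2 / n := by
        gcongr; exact le_max_left _ _
    _ ≤ max C₃₃ 0 * bigP D ^ 2 * (K ^ 2 * (majorantConst 64 16 * Real.log M ^ 64)) :=
        mul_le_mul_of_nonneg_left hW1 (mul_nonneg (le_max_right _ _) hP)

/-! ## The fourth moment of `F(1−s,ψ̄)` (its square is a polynomial of length `≤ P²`) -/

/-- **`Σ_{ψ∈Ψ}|F(1−s,ψ̄)|⁴ ≤ C₃₃P²·majorantConst 16 8·(2𝓛⁹)^{16}`** on `Re s = ½`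
(`F(1−s,ψ̄) = Σ_{n≤D⁴}ν(n)ψ̄(n)n^{s−1}`), once `D⁴·D⁴ ≤ ⌊P²⌋` and `𝓛 ≥ 1`: the square is
`Σ_{k≤P²}(ν′⋆ν′)(k)ψ̄(k)k^{s−1}` (`Section7Eq75.sq_dirPoly_eq`), `|ν′⋆ν′| ≤ τ₄` (`|ν| ≤ τ₂`), the large
sieve after conjugation, and `Σ_{k≤X}τ₄(k)²/k ≤ majorantConst 16 8 (log X)^{16}`.
[cite: Zhang2022LandauSiegel, §7 (7.5) p.35; §3 Lemma 3.3] -/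
theorem sum_pow_four_F_le {D : ℕ} [Fintype (Chr D)] (χ : DirichletCharacter ℂ D) (hℓ : 1 ≤ ell D)
    (hN : D ^ 4 * D ^ 4 ≤ ⌊bigP D ^ 2⌋₊) {C₃₃ : ℝ}
    (h33 : ∀ (s : ℂ) (c : ℕ → ℂ),
      ∑ᶠ x : Chr D, ‖∑ n ∈ Icc 1 ⌊bigP D ^ 2⌋₊, c n * x.ψ (n : ZMod x.p) * (n : ℂ) ^ (-s)‖ ^ 2
        ≤ C₃₃ * bigP D ^ 2 * ∑ n ∈ Icc 1 ⌊bigP D ^ 2⌋₊, ‖c n‖ ^ 2 * (n : ℝ) ^ (-2 * s.re))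
    {s : ℂ} (hs : s.re = 1 / 2) :
    ∑ x : Chr D, ‖FpolyBar χ x (1 - s)‖ ^ 4 ≤
      max C₃₃ 0 * bigP D ^ 2 * (majorantConst 16 8 * (2 * ell D ^ 9) ^ 16) := by
  classical
  obtain ⟨hX, hlogX⟩ := floor_bigP_sq_facts hℓ
  set X : ℕ := ⌊bigP D ^ 2⌋₊ with hXdef
  set N : ℕ := D ^ 4 with hNdef
  set w : ℂ := 1 - s with hw
  set a' : ℕ → ℂ := fun n => if n < N + 1 then nu χ n else 0 with ha'
  set b : ℕ → ℂ := seqConv a' a' with hb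
  -- `F(1−s,ψ̄)` as the `a*`-polynomial of the template
  have hF : ∀ x : Chr D, FpolyBar χ x (1 - s) =
      ∑ n ∈ Icc 1 N, nu χ n * conj (x.ψ (n : ZMod x.p)) * (n : ℂ) ^ (s - 1) := by
    intro x
    rw [FpolyBar]
    refine sum_congr rfl fun n _ => ?_
    rw [neg_sub]
  have hsq : ∀ x : Chr D,
      (∑ n ∈ Icc 1 N, nu χ n * conj (x.ψ (n : ZMod x.p)) * (n : ℂ) ^ (s - 1)) ^ 2 =
        ∑ k ∈ Icc 1 X, b k * conj (x.ψ (k : ZMod x.p)) * (k : ℂ) ^ (-w) := by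
    intro x
    have hθ0 : conj (x.ψ ((0 : ℕ) : ZMod x.p)) = 0 := by
      rw [Nat.cast_zero, MulChar.map_nonunit _ not_isUnit_zero, map_zero]
    have hθ : ∀ m n : ℕ, conj (x.ψ ((m * n : ℕ) : ZMod x.p)) =
        conj (x.ψ (m : ZMod x.p)) * conj (x.ψ (n : ZMod x.p)) := by
      intro m n; rw [Nat.cast_mul, map_mul, map_mul]
    have key := Section7Eq75.sq_dirPoly_eq (N + 1) X (by simpa using hN) (nu χ)
      (fun n => conj (x.ψ (n : ZMod x.p))) hθ0 hθ w
    have hrange : ∑ n ∈ Finset.range (N + 1), nu χ n * conj (x.ψ (n : ZMod x.p)) * (n : ℂ) ^ (-w) =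
        ∑ n ∈ Icc 1 N, nu χ n * conj (x.ψ (n : ZMod x.p)) * (n : ℂ) ^ (s - 1) := by
      rw [Finset.range_eq_Ico, Finset.sum_eq_sum_Ico_succ_bot (Nat.succ_pos N), hθ0, mul_zero,
        zero_mul, zero_add]
      refine sum_congr (by ext n; simp only [Finset.mem_Ico, Finset.mem_Icc]; omega) fun n _ => ?_
      rw [hw, neg_sub, show s - 1 = -(1 - s) by ring, neg_sub]
    rw [← hrange, key]
  have hconj : ∀ x : Chr D,
      ‖∑ k ∈ Icc 1 X, b k * conj (x.ψ (k : ZMod x.p)) * (k : ℂ) ^ (-w)‖ =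
        ‖∑ k ∈ Icc 1 X, conj (b k) * x.ψ (k : ZMod x.p) * (k : ℂ) ^ (-conj w)‖ := by
    intro x
    rw [← Complex.norm_conj, map_sum]
    congr 1
    refine sum_congr rfl fun k _ => ?_
    have hk : conj ((k : ℂ) ^ (-w)) = (k : ℂ) ^ (-conj w) := by
      rw [← map_neg, Complex.cpow_conj _ _ (by rw [Complex.natCast_arg]; exact Real.pi_ne_zero.symm),
        Complex.conj_natCast]
    rw [map_mul, map_mul, Complex.conj_conj, hk]
  have key := h33 (conj w) (fun k => conj (b k))
  rw [finsum_eq_sum_of_fintype] at key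
  have hre : -2 * (conj w).re = -1 := by
    rw [Complex.conj_re, hw, Complex.sub_re, Complex.one_re, hs]; norm_num
  rw [hre] at key
  simp only [Complex.norm_conj, Real.rpow_neg_one] at key
  have hab : ∀ n, n ≠ 0 → ‖a' n‖ ≤ 1 * tau 2 n := by
    intro n _
    simp only [ha']
    split_ifs
    · rw [one_mul]; exact Lemma34.norm_nu_le χ n
    · rw [norm_zero, one_mul]; exact tau_nonneg _ _
  have hmom := sum_norm_seqConv_tau_two_sq_div_le (zero_le_one) hab hX
  have hM : 0 < majorantConst 16 8 := majorantConst_pos _ _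
  have hlog0 : 0 ≤ Real.log (X : ℝ) := Real.log_natCast_nonneg X
  have hmom' : ∑ k ∈ Icc 1 X, ‖b k‖ ^ 2 * (k : ℝ)⁻¹ ≤ majorantConst 16 8 * (2 * ell D ^ 9) ^ 16 := by
    simp only [← div_eq_mul_inv]
    refine hmom.trans ?_
    rw [one_pow, one_mul]
    exact mul_le_mul_of_nonneg_left (pow_le_pow_left₀ hlog0 hlogX 16) hM.le
  calc ∑ x : Chr D, ‖FpolyBar χ x (1 - s)‖ ^ 4
      = ∑ x : Chr D, ‖∑ k ∈ Icc 1 X, conj (b k) * x.ψ (k : ZMod x.p) * (k : ℂ) ^ (-conj w)‖ ^ 2 := by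
        refine sum_congr rfl fun x _ => ?_
        rw [hF x, show (4 : ℕ) = 2 * 2 by norm_num, pow_mul, ← norm_pow, hsq x, hconj x]
    _ ≤ C₃₃ * bigP D ^ 2 * ∑ k ∈ Icc 1 X, ‖b k‖ ^ 2 * (k : ℝ)⁻¹ := key
    _ ≤ max C₃₃ 0 * bigP D ^ 2 * ∑ k ∈ Icc 1 X, ‖b k‖ ^ 2 * (k : ℝ)⁻¹ := by
        gcongr; exact le_max_left _ _
    _ ≤ max C₃₃ 0 * bigP D ^ 2 * (majorantConst 16 8 * (2 * ell D ^ 9) ^ 16) :=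
        mul_le_mul_of_nonneg_left hmom' (mul_nonneg (le_max_right _ _) (sq_nonneg _))

/-! ## Sizes of the cut `M = D^{240}` -/

/-- For `D ≥ 3` with `𝓛 ≥ 3`: `2 ≤ D^{240} ≤ ⌊P²⌋`, `log D^{240} = 240𝓛`, and `D⁴·D⁴ ≤ ⌊P²⌋`
(`P² = e^{2𝓛⁹}`, `D^k = e^{k𝓛}`, `k𝓛 ≤ 2𝓛⁹` for `k ≤ 2·3⁸`). [cite: Zhang2022LandauSiegel, §2 (2.1), (2.6)] -/
theorem cut_sizes {D : ℕ} (hD3 : 3 ≤ D) (hℓ : 3 ≤ ell D) :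
    2 ≤ D ^ 240 ∧ D ^ 240 ≤ ⌊bigP D ^ 2⌋₊ ∧ Real.log ((D ^ 240 : ℕ) : ℝ) = 240 * ell D ∧
      D ^ 4 * D ^ 4 ≤ ⌊bigP D ^ 2⌋₊ := by
  have hD0 : (0 : ℝ) < D := by exact_mod_cast lt_of_lt_of_le (by norm_num) hD3
  have hDexp : (D : ℝ) = Real.exp (ell D) := by rw [ell, Real.exp_log hD0]
  have hP2 : bigP D ^ 2 = Real.exp (2 * ell D ^ 9) := by
    rw [bigP, ← Real.exp_nat_mul]; norm_num
  have hℓ8 : (3 : ℝ) ^ 8 ≤ ell D ^ 8 := pow_le_pow_left₀ (by norm_num) hℓ 8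
  have hpow : ∀ k : ℕ, (k : ℝ) ≤ 2 * 3 ^ 8 → ((D ^ k : ℕ) : ℝ) ≤ bigP D ^ 2 := by
    intro k hk
    push_cast
    rw [hDexp, ← Real.exp_nat_mul, hP2, Real.exp_le_exp]
    have h9 : ell D ^ 9 = ell D ^ 8 * ell D := by ring
    rw [h9]
    have hℓ0 : 0 ≤ ell D := by linarith
    nlinarith
  refine ⟨?_, ?_, ?_, ?_⟩
  · calc 2 ≤ 3 ^ 240 := by norm_num
      _ ≤ D ^ 240 := Nat.pow_le_pow_left hD3 240
  · exact Nat.le_floor (hpow 240 (by norm_num))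
  · push_cast
    rw [Real.log_pow, ell]
    norm_num
  · rw [← pow_add]
    exact Nat.le_floor (hpow 8 (by norm_num))

/-! ## The Hölder core on the critical segment -/

/-- **The (17.2)-instance of the display proving (7.5)** (GIVEN nothing: Proposition 2.1 and Lemma 3.3
(ii) are theorems of the tree): there is `K` such that for all large `D`, every real primitive `χ (mod D)`
with (A), and every `s` with `Re s = ½`:
`Σ_{ψ∈Ψ₂} |Σ_{m≤D^{240}} ν*(m)ψ(m)m^{−s}|·|F(1−s,ψ̄)| ≤ K·𝔓·𝓛⁻⁵⁹`
(`X⁴ ≤ U²V·#Ψ₂ ≤ (c_UP²𝓛⁶⁴)²(c_VP²𝓛¹⁴⁴)(C₂₁𝔓𝓛⁻⁷³⁹)`, `P² ≤ 2𝔓𝓛⁷⁷` ⇒ `X⁴ ≤ c𝔓⁴𝓛⁻²³⁶`).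
[cite: Zhang2022LandauSiegel, §17 (17.2) p.95; §7 (7.5) p.35] -/
theorem core172 (c' : ℝ) :
    ∃ K : ℝ, ForAllLarge fun D _ χ => AssumptionA D χ → ∀ s : ℂ, s.re = 1 / 2 →
      ∑ x ∈ finsetOf (PsiTwo χ),
        ‖∑ m ∈ Icc 1 (D ^ 240), nuStar c' χ m * psiFn x m * (m : ℂ) ^ (-s)‖ *
          ‖FpolyBar χ x (1 - s)‖ ≤ K * frakP D * (ell D ^ 59)⁻¹ := by
  obtain ⟨C₂₁, D₁, hD₁⟩ := prop21_holds
  obtain ⟨C₃₃, h33⟩ := lemma33b_holds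
  set Kι : ℝ := (1 + ‖iota2‖) * (‖iota3‖ + ‖iota4‖) with hKι
  have hKι0 : 0 ≤ Kι := Kiota_nonneg
  set cU : ℝ := max C₃₃ 0 * (Kι ^ 2 * (majorantConst 64 16 * 240 ^ 64)) with hcU
  set cV : ℝ := max C₃₃ 0 * (majorantConst 16 8 * 2 ^ 16) with hcV
  set c : ℝ := 8 * cU ^ 2 * cV * max C₂₁ 0 with hc
  have hM64 := majorantConst_pos 64 16; have hM16 := majorantConst_pos 16 8
  have hcU0 : 0 ≤ cU := by positivity
  have hcV0 : 0 ≤ cV := by positivity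
  have hc0 : 0 ≤ c := by positivity
  refine ⟨1 + c, ?_⟩
  obtain ⟨D₂, hD₂⟩ := bigP_sq_le
  obtain ⟨D₃, hD₃⟩ := Section7Eq75.exists_nat_le_ell 3
  refine ⟨max (max D₁ D₂) (max D₃ 3), fun D _ χ hD hq hp hA s hs => ?_⟩
  simp only [max_le_iff] at hD
  obtain ⟨⟨hD₁', hD₂'⟩, hD₃', hD3⟩ := hD
  have hℓ3 : 3 ≤ ell D := hD₃ D hD₃'
  have hℓ : 1 ≤ ell D := by linarith
  have hℓ0 : 0 < ell D := by linarith
  have hlog2 : 2 ≤ Real.log D := le_trans (by norm_num) hℓ3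
  haveI : Fintype (Chr D) := Fintype.ofFinite _
  obtain ⟨hM2, hMP, hlogM, hN⟩ := cut_sizes hD3 hℓ3
  set ℓ : ℝ := ell D with hℓdef; set Pf : ℝ := frakP D with hPf
  have hPf0 : 0 ≤ Pf := by
    rw [hPf, frakP_eq_sum_primeWindow]; exact sum_nonneg fun p _ => Nat.cast_nonneg p
  have hU := sum_sq_head_le c' χ hlog2 (h33 D) hM2 hMP hs
  rw [hlogM] at hU
  have hV := sum_pow_four_F_le χ hℓ hN (h33 D) hs
  have hS : ((finsetOf (PsiTwo χ)).card : ℝ) ≤ max C₂₁ 0 * Pf * (ℓ ^ 739)⁻¹ := by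
    rw [card_finsetOf (Set.toFinite _)]
    refine (hD₁ D χ hD₁' hq hp hA).trans ?_
    exact mul_le_mul_of_nonneg_right (mul_le_mul_of_nonneg_right (le_max_left _ _) hPf0)
      (inv_nonneg.mpr (pow_nonneg hℓ0.le _))
  have hP2 : bigP D ^ 2 ≤ 2 * Pf * ℓ ^ 77 := hD₂ D hD₂'
  have hP20 : 0 ≤ bigP D ^ 2 := sq_nonneg _
  have hU' : ∑ x : Chr D, ‖∑ m ∈ Icc 1 (D ^ 240), nuStar c' χ m * psiFn x m * (m : ℂ) ^ (-s)‖ ^ 2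
      ≤ cU * bigP D ^ 2 * ℓ ^ 64 := by
    refine hU.trans (le_of_eq ?_); rw [hcU, mul_pow]; ring
  have hV' : ∑ x : Chr D, ‖FpolyBar χ x (1 - s)‖ ^ 4 ≤ cV * bigP D ^ 2 * ℓ ^ 144 := by
    refine hV.trans (le_of_eq ?_); rw [hcV, mul_pow, ← pow_mul]; ring
  have hX4 := pow_four_le (finsetOf (PsiTwo χ)) Finset.univ (Finset.subset_univ _)
    (fun x : Chr D => ‖∑ m ∈ Icc 1 (D ^ 240), nuStar c' χ m * psiFn x m * (m : ℂ) ^ (-s)‖)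
    (fun x : Chr D => ‖FpolyBar χ x (1 - s)‖)
    (fun _ => norm_nonneg _) (fun _ => norm_nonneg _)
  have hUn : 0 ≤ ∑ x : Chr D,
      ‖∑ m ∈ Icc 1 (D ^ 240), nuStar c' χ m * psiFn x m * (m : ℂ) ^ (-s)‖ ^ 2 :=
    sum_nonneg fun x _ => sq_nonneg _
  have hVn : 0 ≤ ∑ x : Chr D, ‖FpolyBar χ x (1 - s)‖ ^ 4 := sum_nonneg fun x _ => by positivity
  have h1 := hX4.trans (mul_le_mul (pow_le_pow_left₀ hUn hU' 2) (mul_le_mul hV' hS (Nat.cast_nonneg _)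
    (hVn.trans hV')) (mul_nonneg hVn (Nat.cast_nonneg _)) (sq_nonneg _))
  have h2 : (cU * bigP D ^ 2 * ℓ ^ 64) ^ 2 *
      ((cV * bigP D ^ 2 * ℓ ^ 144) * (max C₂₁ 0 * Pf * (ℓ ^ 739)⁻¹)) ≤
      (cU * (2 * Pf * ℓ ^ 77) * ℓ ^ 64) ^ 2 *
        ((cV * (2 * Pf * ℓ ^ 77) * ℓ ^ 144) * (max C₂₁ 0 * Pf * (ℓ ^ 739)⁻¹)) := by
    have : 0 ≤ (ℓ ^ 739)⁻¹ := inv_nonneg.mpr (pow_nonneg hℓ0.le _)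
    gcongr
  have h3 : (cU * (2 * Pf * ℓ ^ 77) * ℓ ^ 64) ^ 2 *
      ((cV * (2 * Pf * ℓ ^ 77) * ℓ ^ 144) * (max C₂₁ 0 * Pf * (ℓ ^ 739)⁻¹)) =
      c * Pf ^ 4 * (ℓ ^ 236)⁻¹ := by
    rw [hc]; field_simp; ring
  have h4 : c * Pf ^ 4 * (ℓ ^ 236)⁻¹ ≤ ((1 + c) * Pf * (ℓ ^ 59)⁻¹) ^ 4 := by
    have hK : c ≤ (1 + c) ^ 4 :=
      (le_add_of_nonneg_left zero_le_one).trans (le_self_pow₀ (by linarith) (by norm_num))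
    calc c * Pf ^ 4 * (ℓ ^ 236)⁻¹ ≤ (1 + c) ^ 4 * Pf ^ 4 * (ℓ ^ 236)⁻¹ := by gcongr
      _ = ((1 + c) * Pf * (ℓ ^ 59)⁻¹) ^ 4 := by rw [mul_pow, mul_pow, inv_pow, ← pow_mul]
  have hK0 : 0 ≤ (1 + c) * Pf * (ℓ ^ 59)⁻¹ := by positivity
  exact le_of_pow_le_pow_left₀ (by norm_num) hK0 (h1.trans (h2.trans (h3.le.trans h4)))

/-! ## Summing `‖(1/2πi)∫_{𝔍(0)} K_M F̄ ω‖` over `Ψ₂`: the weight `∫_{𝔍(0)}|ω||ds| ≪ 1` -/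

/-- **On `𝔍(0)` the head integrals are small over `Ψ₂`**: with the constant `K` of `core172` and `C₇₄`
of (7.4) (`Section7aStatements.eq74_holds`), for all large `D` and under (A),
`Σ_{ψ∈Ψ₂}‖(1/2πi)∫_{𝔍(0)}K_M(s,ψ)F(1−s,ψ̄)ω(s)ds‖ ≤ (C₇₄/(2π))·K·𝔓·𝓛⁻⁵⁹` (interchange of the finite
sum with `∫_{−𝓛₁}^{𝓛₁}dv`, `core172` pointwise in `v`, and `∫|ω(s₀+iv)|dv ≤ C₇₄`).
[cite: Zhang2022LandauSiegel, §7 (7.4)–(7.5) pp.34–35; §17 (17.2) p.95] -/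
theorem sum_PsiTwo_norm_segInt_head_le (c' : ℝ) :
    ∃ K : ℝ, ForAllLarge fun D _ χ => AssumptionA D χ →
      ∑ x ∈ finsetOf (PsiTwo χ),
        ‖Lemma81.segInt (t0 D) (ell1 D) 0 (fun s =>
          (∑ m ∈ Icc 1 (D ^ 240), nuStar c' χ m * psiFn x m * (m : ℂ) ^ (-s)) *
            FpolyBar χ x (1 - s) * omegaW D s)‖ ≤ K * frakP D * (ell D ^ 59)⁻¹ := by
  obtain ⟨K, hK⟩ := core172 c'
  obtain ⟨C₇₄, h74⟩ := Section7aStatements.eq74_holds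
  refine ⟨C₇₄ / (2 * π) * max K 0, ?_⟩
  obtain ⟨D₃, hD₃⟩ := Section7Eq75.exists_nat_le_ell 3
  refine ((hK.and h74).and (forAllLarge_ge D₃)).mono ?_
  intro D _ χ hq hp h hA
  obtain ⟨⟨hcore, h74D⟩, hD3⟩ := h
  have hℓ3 : 3 ≤ ell D := hD₃ D hD3
  have hℓ0 : 0 < ell D := by linarith
  have hℓ10 : 0 ≤ ell1 D := pow_nonneg hℓ0.le _
  set Pf : ℝ := frakP D with hPf
  have hPf0 : 0 ≤ Pf := by
    rw [hPf, frakP_eq_sum_primeWindow]; exact sum_nonneg fun p _ => Nat.cast_nonneg p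
  set X₀ : ℝ := max K 0 * Pf * (ell D ^ 59)⁻¹ with hX₀
  have hX₀0 : 0 ≤ X₀ := by positivity
  -- the points of `𝔍(0)`
  have hre : ∀ v : ℝ, ((0 : ℂ) + s0 D + v * I).re = 1 / 2 := by
    intro v; rw [s0, SmoothWeight.s0_def]; simp
  have him : ∀ v : ℝ, 1 - ((0 : ℂ) + s0 D + v * I) = 1 - ((0 : ℂ) + s0 D + v * I) := fun v => rfl
  -- pointwise Hölder bound along the segment
  have hpt : ∀ v : ℝ, ∑ x ∈ finsetOf (PsiTwo χ),
      ‖(∑ m ∈ Icc 1 (D ^ 240), nuStar c' χ m * psiFn x m * (m : ℂ) ^ (-((0 : ℂ) + s0 D + v * I))) *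
        FpolyBar χ x (1 - ((0 : ℂ) + s0 D + v * I)) * omegaW D ((0 : ℂ) + s0 D + v * I)‖ ≤
      X₀ * ‖omegaW D ((0 : ℂ) + s0 D + v * I)‖ := by
    intro v
    set s : ℂ := (0 : ℂ) + s0 D + v * I with hs
    have h := hcore hA s (hre v)
    calc ∑ x ∈ finsetOf (PsiTwo χ), ‖(∑ m ∈ Icc 1 (D ^ 240),
          nuStar c' χ m * psiFn x m * (m : ℂ) ^ (-s)) * FpolyBar χ x (1 - s) * omegaW D s‖
        = (∑ x ∈ finsetOf (PsiTwo χ), ‖∑ m ∈ Icc 1 (D ^ 240),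
          nuStar c' χ m * psiFn x m * (m : ℂ) ^ (-s)‖ * ‖FpolyBar χ x (1 - s)‖) * ‖omegaW D s‖ := by
          rw [sum_mul]
          exact sum_congr rfl fun x _ => by rw [norm_mul, norm_mul]
      _ ≤ (K * Pf * (ell D ^ 59)⁻¹) * ‖omegaW D s‖ := mul_le_mul_of_nonneg_right h (norm_nonneg _)
      _ ≤ X₀ * ‖omegaW D s‖ := by
          apply mul_le_mul_of_nonneg_right _ (norm_nonneg _)
          rw [hX₀]; gcongr; exact le_max_left _ _
  -- each head integrand is continuous along the segment
  have hcont : ∀ x : Chr D, Continuous fun v : ℝ =>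
      (∑ m ∈ Icc 1 (D ^ 240), nuStar c' χ m * psiFn x m * (m : ℂ) ^ (-((0 : ℂ) + s0 D + v * I))) *
        FpolyBar χ x (1 - ((0 : ℂ) + s0 D + v * I)) * omegaW D ((0 : ℂ) + s0 D + v * I) := by
    intro x
    have hline : Continuous fun v : ℝ => (0 : ℂ) + s0 D + v * I := by fun_prop
    have h1 : Continuous fun s : ℂ => ∑ m ∈ Icc 1 (D ^ 240), nuStar c' χ m * psiFn x m * (m : ℂ) ^ (-s) :=
      (differentiable_head c' χ x (D ^ 240)).continuous
    have h2 : Continuous fun s : ℂ => FpolyBar χ x (1 - s) :=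
      (differentiable_FpolyBar' χ x).continuous.comp (by fun_prop)
    have h3 : Continuous (omegaW D) := (Section7aStatements.differentiable_omegaW D).continuous
    exact ((h1.mul h2).mul h3).comp hline
  -- norm of each segment integral ≤ (1/2π) ∫ of the norm
  have h2π : ‖(1 / (2 * π) : ℂ)‖ = 1 / (2 * π) := by
    rw [norm_div, norm_one, norm_mul, Complex.norm_real, Real.norm_eq_abs, abs_of_pos Real.pi_pos]
    norm_num
  have hper : ∀ x ∈ finsetOf (PsiTwo χ),
      ‖Lemma81.segInt (t0 D) (ell1 D) 0 (fun s =>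
          (∑ m ∈ Icc 1 (D ^ 240), nuStar c' χ m * psiFn x m * (m : ℂ) ^ (-s)) *
            FpolyBar χ x (1 - s) * omegaW D s)‖ ≤
        1 / (2 * π) * ∫ v in (-ell1 D)..ell1 D,
          ‖(∑ m ∈ Icc 1 (D ^ 240), nuStar c' χ m * psiFn x m * (m : ℂ) ^ (-((0 : ℂ) + s0 D + v * I))) *
            FpolyBar χ x (1 - ((0 : ℂ) + s0 D + v * I)) * omegaW D ((0 : ℂ) + s0 D + v * I)‖ := by
    intro x _
    rw [Lemma81.segInt_def, norm_mul, h2π]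
    refine mul_le_mul_of_nonneg_left ?_ (by positivity)
    exact intervalIntegral.norm_integral_le_integral_norm (by linarith)
  -- sum over Ψ₂, interchange, pointwise bound, (7.4)
  have hsum_int : ∑ x ∈ finsetOf (PsiTwo χ), ∫ v in (-ell1 D)..ell1 D,
      ‖(∑ m ∈ Icc 1 (D ^ 240), nuStar c' χ m * psiFn x m * (m : ℂ) ^ (-((0 : ℂ) + s0 D + v * I))) *
        FpolyBar χ x (1 - ((0 : ℂ) + s0 D + v * I)) * omegaW D ((0 : ℂ) + s0 D + v * I)‖ =
      ∫ v in (-ell1 D)..ell1 D, ∑ x ∈ finsetOf (PsiTwo χ),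
        ‖(∑ m ∈ Icc 1 (D ^ 240), nuStar c' χ m * psiFn x m * (m : ℂ) ^ (-((0 : ℂ) + s0 D + v * I))) *
          FpolyBar χ x (1 - ((0 : ℂ) + s0 D + v * I)) * omegaW D ((0 : ℂ) + s0 D + v * I)‖ := by
    rw [intervalIntegral.integral_finsetSum]
    intro x _
    exact ((hcont x).norm).intervalIntegrable _ _
  have hωc : Continuous fun v : ℝ => ‖omegaW D ((0 : ℂ) + s0 D + v * I)‖ :=
    ((Section7aStatements.differentiable_omegaW D).continuous.comp (by fun_prop)).norm
  have hint_le : ∫ v in (-ell1 D)..ell1 D, ∑ x ∈ finsetOf (PsiTwo χ),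
      ‖(∑ m ∈ Icc 1 (D ^ 240), nuStar c' χ m * psiFn x m * (m : ℂ) ^ (-((0 : ℂ) + s0 D + v * I))) *
        FpolyBar χ x (1 - ((0 : ℂ) + s0 D + v * I)) * omegaW D ((0 : ℂ) + s0 D + v * I)‖ ≤
      ∫ v in (-ell1 D)..ell1 D, X₀ * ‖omegaW D ((0 : ℂ) + s0 D + v * I)‖ := by
    refine intervalIntegral.integral_mono_on (by linarith) ?_ ?_ fun v _ => hpt v
    · exact (continuous_finsetSum _ fun x _ => (hcont x).norm).intervalIntegrable _ _
    · exact (hωc.const_mul _).intervalIntegrable _ _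
  have h74' : ∫ v in (-ell1 D)..ell1 D, ‖omegaW D ((0 : ℂ) + s0 D + v * I)‖ ≤ C₇₄ := by
    have h := h74D 0 (by rw [abs_zero]; positivity)
    rw [Section7aStatements.absIntJ] at h
    simpa using h
  have hC74 : 0 ≤ C₇₄ := le_trans (intervalIntegral.integral_nonneg (by linarith) fun v _ => norm_nonneg _) h74'
  calc ∑ x ∈ finsetOf (PsiTwo χ), ‖Lemma81.segInt (t0 D) (ell1 D) 0 (fun s =>
          (∑ m ∈ Icc 1 (D ^ 240), nuStar c' χ m * psiFn x m * (m : ℂ) ^ (-s)) *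
            FpolyBar χ x (1 - s) * omegaW D s)‖
      ≤ ∑ x ∈ finsetOf (PsiTwo χ), 1 / (2 * π) * ∫ v in (-ell1 D)..ell1 D,
          ‖(∑ m ∈ Icc 1 (D ^ 240), nuStar c' χ m * psiFn x m * (m : ℂ) ^ (-((0 : ℂ) + s0 D + v * I))) *
            FpolyBar χ x (1 - ((0 : ℂ) + s0 D + v * I)) * omegaW D ((0 : ℂ) + s0 D + v * I)‖ :=
        sum_le_sum hper
    _ = 1 / (2 * π) * ∫ v in (-ell1 D)..ell1 D, ∑ x ∈ finsetOf (PsiTwo χ),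
          ‖(∑ m ∈ Icc 1 (D ^ 240), nuStar c' χ m * psiFn x m * (m : ℂ) ^ (-((0 : ℂ) + s0 D + v * I))) *
            FpolyBar χ x (1 - ((0 : ℂ) + s0 D + v * I)) * omegaW D ((0 : ℂ) + s0 D + v * I)‖ := by
        rw [← mul_sum, hsum_int]
    _ ≤ 1 / (2 * π) * ∫ v in (-ell1 D)..ell1 D, X₀ * ‖omegaW D ((0 : ℂ) + s0 D + v * I)‖ :=
        mul_le_mul_of_nonneg_left hint_le (by positivity)
    _ = 1 / (2 * π) * (X₀ * ∫ v in (-ell1 D)..ell1 D, ‖omegaW D ((0 : ℂ) + s0 D + v * I)‖) := by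
        rw [intervalIntegral.integral_const_mul]
    _ ≤ 1 / (2 * π) * (X₀ * C₇₄) := by gcongr
    _ = C₇₄ / (2 * π) * max K 0 * frakP D * (ell D ^ 59)⁻¹ := by rw [hX₀]; ring

/-! ## The extension error `Σ_{ψ∈Ψ₂}` -/

/-- `c𝓛ᵏ ≤ D` eventually (`𝓛^{k+1} ≤ (k+1)!·e^{𝓛} = (k+1)!·D`). [cite: Zhang2022LandauSiegel, §2 (2.1)] -/
theorem const_mul_ell_pow_le_self (k : ℕ) (c : ℝ) : ∃ D₀ : ℕ, ∀ D : ℕ, D₀ ≤ D → c * ell D ^ k ≤ D := by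
  obtain ⟨D₀, hD₀⟩ := Section7Eq75.exists_nat_le_ell (max 1 (c * (k + 1).factorial))
  refine ⟨max D₀ 1, fun D hD => ?_⟩
  have hD₀' : D₀ ≤ D := le_trans (le_max_left _ _) hD
  have hD1 : 1 ≤ D := le_trans (le_max_right _ _) hD
  have hℓ := hD₀ D hD₀'
  have hℓ1 : 1 ≤ ell D := le_trans (le_max_left _ _) hℓ
  have hℓc : c * (k + 1).factorial ≤ ell D := le_trans (le_max_right _ _) hℓ
  have hℓ0 : 0 < ell D := by linarith
  have hD0 : (0 : ℝ) < D := by exact_mod_cast hD1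
  have hDexp : Real.exp (ell D) = D := by rw [ell, Real.exp_log hD0]
  have h1 : ell D ^ (k + 1) ≤ (k + 1).factorial * Real.exp (ell D) := by
    have := Real.pow_div_factorial_le_exp (ell D) hℓ0.le (k + 1)
    rwa [div_le_iff₀ (by exact_mod_cast Nat.factorial_pos _), mul_comm] at this
  rcases le_or_gt c 0 with hc | hc
  · exact le_trans (mul_nonpos_of_nonpos_of_nonneg hc (pow_nonneg hℓ0.le _)) hD0.le
  · have h2 : c * ell D ^ k * ell D ≤ (D : ℝ) * ell D := by
      calc c * ell D ^ k * ell D = c * ell D ^ (k + 1) := by ring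
        _ ≤ c * ((k + 1).factorial * Real.exp (ell D)) := mul_le_mul_of_nonneg_left h1 hc.le
        _ = (c * (k + 1).factorial) * Real.exp (ell D) := by ring
        _ ≤ ell D * Real.exp (ell D) := mul_le_mul_of_nonneg_right hℓc (Real.exp_pos _).le
        _ = (D : ℝ) * ell D := by rw [hDexp, mul_comm]
    exact le_of_mul_le_mul_right h2 hℓ0

/-- The per-character tail constant is eventually small: for every `ε > 0`, eventually
`(𝓛₁/π)·K_ι(D^{240})^{−1/4}S₈·D⁵⁶·3 ≤ ε` (`(D^{240})^{−1/4}D⁵⁶ = D^{−4}`, `𝓛⁴⁰⁵ ≪ D`).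
[cite: Zhang2022LandauSiegel, §17 (17.2) p.95] -/
theorem tail_const_eventually_le (ε : ℝ) (hε : 0 < ε) :
    ∃ D₀ : ℕ, ∀ D : ℕ, D₀ ≤ D →
      (ell1 D / π) * ((1 + ‖iota2‖) * (‖iota3‖ + ‖iota4‖) * (((D ^ 240 : ℕ) : ℝ)) ^ (-(1 / 4 : ℝ)) *
        ∑' n : ℕ, tau 8 n / (n : ℝ) ^ (5 / 4 : ℝ)) * (D : ℝ) ^ 56 * 3 ≤ ε := by
  set Kι : ℝ := (1 + ‖iota2‖) * (‖iota3‖ + ‖iota4‖) with hKι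
  have hKι0 : 0 ≤ Kι := Kiota_nonneg
  set S₈ : ℝ := ∑' n : ℕ, tau 8 n / (n : ℝ) ^ (5 / 4 : ℝ) with hS₈
  have hS₈0 : 0 ≤ S₈ := tsum_nonneg fun n => div_nonneg (tau_nonneg _ _) (by positivity)
  -- `c𝓛⁴⁰⁵ ≤ D` with `c = 3 Kι S₈ / (π ε)`
  obtain ⟨D₀, hD₀⟩ := const_mul_ell_pow_le_self 405 (3 * Kι * S₈ / (π * ε))
  refine ⟨max D₀ 1, fun D hD => ?_⟩
  have hD₀' : D₀ ≤ D := le_trans (le_max_left _ _) hD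
  have hD1 : 1 ≤ D := le_trans (le_max_right _ _) hD
  have hD0 : (0 : ℝ) < D := by exact_mod_cast hD1
  have hkey := hD₀ D hD₀'
  -- `(D^240)^{-1/4} = D^{-60}`
  have hM : (((D ^ 240 : ℕ) : ℝ)) ^ (-(1 / 4 : ℝ)) = ((D : ℝ) ^ 60)⁻¹ := by
    rw [Nat.cast_pow, ← Real.rpow_natCast (D : ℝ) 240, ← Real.rpow_mul hD0.le,
      ← Real.rpow_natCast (D : ℝ) 60, ← Real.rpow_neg hD0.le]
    norm_num
  rw [hM, ell1]
  have hD60 : (0 : ℝ) < (D : ℝ) ^ 60 := pow_pos hD0 60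
  have hℓ0 : 0 ≤ ell D := Real.log_natCast_nonneg D
  have hπ0 : 0 < π := Real.pi_pos
  -- `D⁵⁶/D⁶⁰ = 1/D⁴ ≤ 1/D`
  have hD4 : (D : ℝ) ^ 56 * ((D : ℝ) ^ 60)⁻¹ ≤ (D : ℝ)⁻¹ := by
    rw [← div_eq_mul_inv, div_le_iff₀ hD60, ← div_eq_inv_mul]
    rw [le_div_iff₀ hD0]
    have : (D : ℝ) ^ 56 * D = (D : ℝ) ^ 57 := by ring
    rw [this]
    exact pow_le_pow_right₀ (by exact_mod_cast hD1) (by norm_num)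
  -- LHS = (3 Kι S₈/π)·𝓛⁴⁰⁵·(D⁵⁶/D⁶⁰)
  have hexpr : ell D ^ 405 / π * (Kι * ((D : ℝ) ^ 60)⁻¹ * S₈) * (D : ℝ) ^ 56 * 3 =
      (3 * Kι * S₈ / π * ell D ^ 405) * ((D : ℝ) ^ 56 * ((D : ℝ) ^ 60)⁻¹) := by ring
  rw [hexpr]
  have hc0 : 0 ≤ 3 * Kι * S₈ / π * ell D ^ 405 :=
    mul_nonneg (div_nonneg (mul_nonneg (mul_nonneg (by norm_num) hKι0) hS₈0) hπ0.le) (pow_nonneg hℓ0 _)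
  -- `(3KιS₈/π)𝓛⁴⁰⁵ ≤ εD` from `hkey`
  have hkey' : 3 * Kι * S₈ / π * ell D ^ 405 ≤ ε * D := by
    have h := mul_le_mul_of_nonneg_left hkey hε.le
    calc 3 * Kι * S₈ / π * ell D ^ 405 = ε * (3 * Kι * S₈ / (π * ε) * ell D ^ 405) := by
          field_simp
      _ ≤ ε * D := h
  calc 3 * Kι * S₈ / π * ell D ^ 405 * ((D : ℝ) ^ 56 * ((D : ℝ) ^ 60)⁻¹)
      ≤ (ε * D) * (D : ℝ)⁻¹ := mul_le_mul hkey' hD4 (by positivity) (by positivity)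
    _ = ε := by field_simp

/-- The per-character shift constant is eventually small: for every `ε > 0`, eventually
`(1/π)·K_ι(D^{240})⁸D⁵⁶·6e^{−𝓛¹⁰/4} ≤ ε` (`D^{1976} = e^{1976𝓛}`, `1976𝓛 + 𝓛 ≤ 𝓛¹⁰/4` for `𝓛 ≥ 3`).
[cite: Zhang2022LandauSiegel, §17 (17.2) p.95] -/
theorem shift_const_eventually_le (ε : ℝ) (hε : 0 < ε) :
    ∃ D₀ : ℕ, ∀ D : ℕ, D₀ ≤ D →
      (1 / π) * ((1 + ‖iota2‖) * (‖iota3‖ + ‖iota4‖) * (((D ^ 240 : ℕ) : ℝ)) ^ 8 * (D : ℝ) ^ 56 *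
        (6 * Real.exp (-(ell D ^ 10) / 4))) ≤ ε := by
  set Kι : ℝ := (1 + ‖iota2‖) * (‖iota3‖ + ‖iota4‖) with hKι
  have hKι0 : 0 ≤ Kι := Kiota_nonneg
  obtain ⟨D₀, hD₀⟩ := const_mul_ell_pow_le_self 0 (6 * Kι / (π * ε))
  obtain ⟨D₁, hD₁⟩ := Section7Eq75.exists_nat_le_ell 3
  refine ⟨max (max D₀ D₁) 1, fun D hD => ?_⟩
  have hD₀' : D₀ ≤ D := le_trans (le_trans (le_max_left _ _) (le_max_left _ _)) hD
  have hD₁' : D₁ ≤ D := le_trans (le_trans (le_max_right _ _) (le_max_left _ _)) hD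
  have hD1 : 1 ≤ D := le_trans (le_max_right _ _) hD
  have hD0 : (0 : ℝ) < D := by exact_mod_cast hD1
  have hℓ3 : 3 ≤ ell D := hD₁ D hD₁'
  have hkey : 6 * Kι / (π * ε) ≤ D := by have := hD₀ D hD₀'; simpa using this
  have hDexp : (D : ℝ) = Real.exp (ell D) := by rw [ell, Real.exp_log hD0]
  -- `(D^240)^8 D^56 e^{-𝓛¹⁰/4} = e^{1976𝓛 − 𝓛¹⁰/4} ≤ e^{−𝓛} = D⁻¹`
  have hpow : (((D ^ 240 : ℕ) : ℝ)) ^ 8 * (D : ℝ) ^ 56 * Real.exp (-(ell D ^ 10) / 4) ≤ (D : ℝ)⁻¹ := by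
    push_cast
    rw [← pow_mul, ← pow_add, hDexp, ← Real.exp_nat_mul, ← Real.exp_add, ← Real.exp_neg,
      Real.exp_le_exp]
    norm_num
    have hℓ0 : 0 ≤ ell D := by linarith
    have hℓ8 : (3 : ℝ) ^ 8 ≤ ell D ^ 8 := pow_le_pow_left₀ (by norm_num) hℓ3 8
    have h9 : ell D ^ 10 = ell D ^ 8 * (ell D * ell D) := by ring
    rw [h9]
    have hA : 6561 * (ell D * ell D) ≤ ell D ^ 8 * (ell D * ell D) := by
      have h := mul_le_mul_of_nonneg_right hℓ8 (mul_nonneg hℓ0 hℓ0)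
      norm_num at h
      exact h
    have hB : 3 * ell D ≤ ell D * ell D := by nlinarith
    linarith
  have hπ0 : 0 < π := Real.pi_pos
  have hc0 : 0 ≤ 1 / π * (Kι * 6) := mul_nonneg (by positivity) (mul_nonneg hKι0 (by norm_num))
  have hkey' : 6 * Kι ≤ π * ε * D := by
    have h := mul_le_mul_of_nonneg_left hkey (mul_pos hπ0 hε).le
    calc 6 * Kι = π * ε * (6 * Kι / (π * ε)) := by field_simp
      _ ≤ π * ε * D := h
  calc 1 / π * (Kι * (((D ^ 240 : ℕ) : ℝ)) ^ 8 * (D : ℝ) ^ 56 * (6 * Real.exp (-(ell D ^ 10) / 4)))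
      = 1 / π * (Kι * 6) * ((((D ^ 240 : ℕ) : ℝ)) ^ 8 * (D : ℝ) ^ 56 * Real.exp (-(ell D ^ 10) / 4)) := by
        ring
    _ ≤ 1 / π * (Kι * 6) * (D : ℝ)⁻¹ := mul_le_mul_of_nonneg_left hpow hc0
    _ ≤ ε := by
        rw [← div_eq_mul_inv, div_le_iff₀ hD0]
        calc 1 / π * (Kι * 6) = (6 * Kι) / π := by ring
          _ ≤ (π * ε * D) / π := div_le_div_of_nonneg_right hkey' hπ0.le
          _ = ε * D := by field_simp

/-- **(17.2), the `Ψ₁ → Ψ` extension error** ("extend the sum over `Ψ₁` to the sum over `Ψ` with an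
acceptable error"): for every `ε > 0`, for all large `D` and every real primitive `χ (mod D)` with (A),
`Σ_{ψ∈Ψ₂} ‖(1/2πi)∫_{𝔍(1)}𝔨₃(s,ψ)ω(s)ds‖ ≤ ε𝔓`. Per character (ALL of `Ψ`): truncate the `ν*`-series
at `M = D^{240}` (tail `≪ 𝓛⁴⁰⁵D⁻⁴`) and move the entire head integrand to `𝔍(0)` (Cauchy, error
`≪ D^{1976}e^{−𝓛¹⁰/4}`) — `Section17Eq172Head`; both per-character errors are summed over
`#Ψ₂ ≤ #Ψ ≤ 𝔓`; on `𝔍(0)` Hölder + Lemma 3.3 (ii) + Proposition 2.1 give `≪ 𝔓𝓛⁻⁵⁹`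
(`sum_PsiTwo_norm_segInt_head_le`). [cite: Zhang2022LandauSiegel, §17 (17.2) p.95; §7 (7.5) p.35] -/
theorem sum_PsiTwo_norm_segInt_kfrak3_le (c' : ℝ) :
    ∀ ε : ℝ, 0 < ε → ForAllLarge fun D _ χ => AssumptionA D χ →
      ∑ x ∈ finsetOf (PsiTwo χ),
        ‖Lemma81.segInt (t0 D) (ell1 D) 1 (fun s => kfrak3 c' χ x s * omegaW D s)‖ ≤ ε * frakP D := by
  intro ε hε
  have hε3 : 0 < ε / 3 := by positivity
  obtain ⟨K, hK⟩ := sum_PsiTwo_norm_segInt_head_le c'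
  obtain ⟨Dt, hDt⟩ := tail_const_eventually_le (ε / 3) hε3
  obtain ⟨Ds, hDs⟩ := shift_const_eventually_le (ε / 3) hε3
  obtain ⟨Dℓ, hDℓ⟩ := Section7Eq75.exists_nat_le_ell (max 3 ((3 * max K 0 / ε) + 1))
  refine (hK.and (forAllLarge_ge (max (max Dt Ds) (max Dℓ 3)))).mono ?_
  intro D _ χ hq hp h hA
  obtain ⟨hhead, hD⟩ := h
  simp only [max_le_iff] at hD
  obtain ⟨⟨hDt', hDs'⟩, hDℓ', hD3⟩ := hD
  have hℓmax := hDℓ D hDℓ'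
  have hℓ3 : 3 ≤ ell D := le_trans (le_max_left _ _) hℓmax
  have hℓK : 3 * max K 0 / ε + 1 ≤ ell D := le_trans (le_max_right _ _) hℓmax
  have hℓ0 : 0 < ell D := by linarith
  have hℓ1 : 1 ≤ ell D := by linarith
  have hD1 : 1 ≤ D := le_trans (by norm_num) hD3
  haveI : Fintype (Chr D) := Fintype.ofFinite _
  set Pf : ℝ := frakP D with hPf
  have hPf0 : 0 ≤ Pf := by
    rw [hPf, frakP_eq_sum_primeWindow]; exact sum_nonneg fun p _ => Nat.cast_nonneg p
  set M : ℕ := D ^ 240 with hMdef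
  have hM0 : 0 < M := by positivity
  -- per-character constants
  set ρ : ℝ := (ell1 D / π) * ((1 + ‖iota2‖) * (‖iota3‖ + ‖iota4‖) * (M : ℝ) ^ (-(1 / 4 : ℝ)) *
    ∑' n : ℕ, tau 8 n / (n : ℝ) ^ (5 / 4 : ℝ)) * (D : ℝ) ^ 56 * 3 with hρ
  set η : ℝ := (1 / π) * ((1 + ‖iota2‖) * (‖iota3‖ + ‖iota4‖) * (M : ℝ) ^ 8 * (D : ℝ) ^ 56 *
    (6 * Real.exp (-(ell D ^ 10) / 4))) with hη
  have hρε : ρ ≤ ε / 3 := by have := hDt D hDt'; rw [hρ, hMdef]; exact this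
  have hηε : η ≤ ε / 3 := by have := hDs D hDs'; rw [hη, hMdef]; exact this
  -- per character: ‖J‖ ≤ ρ + η + ‖segInt 0 head‖
  have hper : ∀ x : Chr D,
      ‖Lemma81.segInt (t0 D) (ell1 D) 1 (fun s => kfrak3 c' χ x s * omegaW D s)‖ ≤
        ρ + η + ‖Lemma81.segInt (t0 D) (ell1 D) 0 (fun s =>
          (∑ m ∈ Icc 1 M, nuStar c' χ m * psiFn x m * (m : ℂ) ^ (-s)) *
            FpolyBar χ x (1 - s) * omegaW D s)‖ := by
    intro x
    have h1 := norm_segInt_kfrak3_sub_head_le c' χ hD3 hℓ3 x hM0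
    have h2 := norm_segInt_head_shift_le c' χ hD1 hℓ3 x M
    set J := Lemma81.segInt (t0 D) (ell1 D) 1 (fun s => kfrak3 c' χ x s * omegaW D s) with hJ
    set G1 := Lemma81.segInt (t0 D) (ell1 D) 1 (fun s =>
      (∑ m ∈ Icc 1 M, nuStar c' χ m * psiFn x m * (m : ℂ) ^ (-s)) *
        FpolyBar χ x (1 - s) * omegaW D s) with hG1
    set G0 := Lemma81.segInt (t0 D) (ell1 D) 0 (fun s =>
      (∑ m ∈ Icc 1 M, nuStar c' χ m * psiFn x m * (m : ℂ) ^ (-s)) *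
        FpolyBar χ x (1 - s) * omegaW D s) with hG0
    calc ‖J‖ = ‖(J - G1) + (G1 - G0) + G0‖ := by ring_nf
      _ ≤ ‖J - G1‖ + ‖G1 - G0‖ + ‖G0‖ := (norm_add_le _ _).trans (add_le_add (norm_add_le _ _) le_rfl)
      _ ≤ ρ + η + ‖G0‖ := add_le_add (add_le_add h1 h2) le_rfl
  -- the count `#Ψ₂ ≤ 𝔓`
  have hcard : ((finsetOf (PsiTwo χ)).card : ℝ) ≤ Pf := by
    have h : (finsetOf (PsiTwo χ)).card ≤ Nat.card (Chr D) := by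
      rw [Nat.card_eq_fintype_card]; exact Finset.card_le_univ _
    exact le_trans (by exact_mod_cast h) (Ded81Edge.natCard_chr_le_frakP D)
  -- the head sum on `𝔍(0)`
  have hX : K * Pf * (ell D ^ 59)⁻¹ ≤ ε / 3 * Pf := by
    have h59 : ell D ≤ ell D ^ 59 := by
      calc ell D = ell D ^ 1 := (pow_one _).symm
        _ ≤ ell D ^ 59 := pow_le_pow_right₀ hℓ1 (by norm_num)
    have hKℓ : K * (ell D ^ 59)⁻¹ ≤ ε / 3 := by
      have hpos : 0 < ell D ^ 59 := by positivity
      rw [← div_eq_mul_inv, div_le_iff₀ hpos]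
      have : 3 * max K 0 / ε ≤ ell D ^ 59 := by linarith
      have h' : 3 * max K 0 ≤ ε * ell D ^ 59 := by
        rw [div_le_iff₀ hε] at this; linarith
      calc K ≤ max K 0 := le_max_left _ _
        _ ≤ ε / 3 * ell D ^ 59 := by linarith
    calc K * Pf * (ell D ^ 59)⁻¹ = (K * (ell D ^ 59)⁻¹) * Pf := by ring
      _ ≤ ε / 3 * Pf := mul_le_mul_of_nonneg_right hKℓ hPf0
  calc ∑ x ∈ finsetOf (PsiTwo χ), ‖Lemma81.segInt (t0 D) (ell1 D) 1 (fun s => kfrak3 c' χ x s * omegaW D s)‖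
      ≤ ∑ x ∈ finsetOf (PsiTwo χ), (ρ + η + ‖Lemma81.segInt (t0 D) (ell1 D) 0 (fun s =>
          (∑ m ∈ Icc 1 M, nuStar c' χ m * psiFn x m * (m : ℂ) ^ (-s)) *
            FpolyBar χ x (1 - s) * omegaW D s)‖) := sum_le_sum fun x _ => hper x
    _ = (finsetOf (PsiTwo χ)).card * (ρ + η) + ∑ x ∈ finsetOf (PsiTwo χ),
          ‖Lemma81.segInt (t0 D) (ell1 D) 0 (fun s =>
            (∑ m ∈ Icc 1 M, nuStar c' χ m * psiFn x m * (m : ℂ) ^ (-s)) *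
              FpolyBar χ x (1 - s) * omegaW D s)‖ := by
        rw [sum_add_distrib, sum_const, nsmul_eq_mul]
    _ ≤ Pf * (ε / 3 + ε / 3) + K * Pf * (ell D ^ 59)⁻¹ := by
        have hρη : 0 ≤ ρ + η := by
          rw [hρ, hη]
          have h1 : 0 ≤ ell1 D := pow_nonneg hℓ0.le _
          have hS : 0 ≤ ∑' n : ℕ, tau 8 n / (n : ℝ) ^ (5 / 4 : ℝ) :=
            tsum_nonneg fun n => div_nonneg (tau_nonneg _ _) (by positivity)
          have hK' : 0 ≤ (1 + ‖iota2‖) * (‖iota3‖ + ‖iota4‖) := Kiota_nonneg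
          have hM1 : 0 ≤ (M : ℝ) ^ (-(1 / 4 : ℝ)) := Real.rpow_nonneg (Nat.cast_nonneg _) _
          have hM2 : 0 ≤ (M : ℝ) ^ 8 := pow_nonneg (Nat.cast_nonneg _) _
          have hD56 : 0 ≤ (D : ℝ) ^ 56 := pow_nonneg (Nat.cast_nonneg _) _
          have hπ : 0 ≤ 1 / π := by positivity
          have hπ' : 0 ≤ ell1 D / π := div_nonneg h1 Real.pi_pos.le
          have he : 0 ≤ 6 * Real.exp (-(ell D ^ 10) / 4) := by positivity
          exact add_nonneg (mul_nonneg (mul_nonneg (mul_nonneg hπ' (mul_nonneg (mul_nonneg hK' hM1) hS))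
            hD56) (by norm_num)) (mul_nonneg hπ (mul_nonneg (mul_nonneg (mul_nonneg hK' hM2) hD56) he))
        exact add_le_add (mul_le_mul hcard (add_le_add hρε hηε) hρη hPf0) (hhead hA)
    _ ≤ Pf * (ε / 3 + ε / 3) + ε / 3 * Pf := by linarith
    _ = ε * frakP D := by rw [hPf]; ring

/-- **The weighted form** consumed by (17.2): `‖Σ_{ψ∈Ψ₂}(p_ψt₀)^{β₃}(1/2πi)∫_{𝔍(1)}𝔨₃ω‖ ≤ ε𝔓`
eventually, since `|(p_ψt₀)^{β₃}| = 1`. [cite: Zhang2022LandauSiegel, §17 (17.2) p.95] -/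
theorem norm_sum_PsiTwo_weighted_le (c' : ℝ) :
    ∀ ε : ℝ, 0 < ε → ForAllLarge fun D _ χ => AssumptionA D χ →
      ‖∑ x ∈ finsetOf (PsiTwo χ), (((x.p : ℝ) * t0 D : ℝ) : ℂ) ^ beta3 c' D *
          Lemma81.segInt (t0 D) (ell1 D) 1 (fun s => kfrak3 c' χ x s * omegaW D s)‖ ≤
        ε * frakP D := by
  intro ε hε
  obtain ⟨Dℓ, hDℓ⟩ := Section7Eq75.exists_nat_le_ell 1
  refine ((sum_PsiTwo_norm_segInt_kfrak3_le c' ε hε).and (forAllLarge_ge Dℓ)).mono ?_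
  intro D _ χ _ _ h hA
  obtain ⟨hmain, hD⟩ := h
  have hℓ1 : 1 ≤ ell D := hDℓ D hD
  have ht0 : 0 < t0 D := by rw [t0]; positivity
  refine (norm_sum_le _ _).trans (le_trans (sum_le_sum fun x _ => ?_) (hmain hA))
  rw [norm_mul, Step8u012Holds.norm_cpow_beta3 x ht0, one_mul]

end Literature.NumberTheory.LFunctions.Zhang2022.Eq172

end
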